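import Summits.QuantumFields.YangMills.Theorems.ContinuumLimitOnTrajectory.Negative.UltralocalTorusHaar

/-!
# `ContinuumLimitOnTrajectory` — negative-side support II: zero coupling — vanishing curvature correlators and the gap clause

Support file 2/4 for crux `stmt-QuantumFields-10522` ((A) of `ParabolicTrajectory`), from the disprover's work
file §2. Tree objects only.

* `wilsonMeasure_zero`: at `β = 0` the torus Wilson measure IS product Haar (cf. the sibling
  `LatticeGapOnTrajectory.Negative.wilsonMeasure_zero_coupling`, proved independently there).
* `latticeConnectedCorr_actionDensity_zero`: `⟨P ; τ_n P⟩_{β=0,S} = 0` for every `n ≢ 0 (mod S)` (`S ≥ 2`);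
  `eventually_corr_eq_zero`, `tendsto_N_zero`: along every `M`-adic scheme at `β ≡ 0` ALL dimensionless
  curvature correlators `N_t(k)` (`t ≥ 1`) are eventually EXACTLY `0` (the tuning clause of (A) holds with
  `θ = 0`, the convergence clause for every `t`; also the IVT base point `N_1 = 0 at β = 0` of crux (S)).
* `hasLatticeMassGap_beta_zero`: at `β ≡ 0` (`a_k ≤ 1`) `HasLatticeMassGap r sch Δ` for EVERY `Δ ≥ 0`
  (independence of disjointly projected supports + translation invariance of the torus Wilson state).
-/

namespace Summit.QuantumFields.YangMills.Theorems.ContinuumLimitOnTrajectory.Negative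

open MeasureTheory Filter Topology
open Literature.MathematicalPhysics.QuantumFieldTheory Literature.MathematicalPhysics.QuantumLattice
open Literature.Probability.LatticeModels (Torus.proj Torus.proj_apply)

noncomputable section

section BetaZero

variable {G : Type} [Group G] [TopologicalSpace G] [IsTopologicalGroup G] [CompactSpace G]
  [MeasurableSpace G] [BorelSpace G]
  {N : ℕ} (ρ : G →* Matrix (Fin N) (Fin N) ℂ) (S : ℕ) [NeZero S]

/-- At `β = 0` the Wilson weight is the product Haar measure. [folklore] -/
theorem wilsonWeight_zero :
    wilsonWeight (d := 4) (L := S) ρ 0 = Measure.pi fun _ : Edge 4 S => haarProbability G := by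
  unfold wilsonWeight
  have : (fun U : GaugeConfig 4 S G => ENNReal.ofReal (Real.exp (-0 * wilsonAction ρ U))) = 1 := by
    funext U; simp
  rw [this, withDensity_one]

/-- **At `β = 0` the torus Wilson measure is the product Haar measure** (independent
Haar-distributed links: the ultralocal theory). [folklore] -/
theorem wilsonMeasure_zero :
    wilsonMeasure (d := 4) (L := S) ρ 0 = piHaar S (G := G) := by
  rw [wilsonMeasure, partitionFunction, wilsonWeight_zero]
  simp [piHaar]

variable [SecondCountableTopology G]

/-- **The curvature time-correlation vanishes identically at `β = 0`** for every separation
`n ≢ 0 (mod S)` on a torus of side `S ≥ 2`: `⟨P ; τ_n P⟩_{β=0,S} = 0`. (Distinct plaquettes are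
uncorrelated under product Haar, even when they share a bond.) [folklore] -/
theorem latticeConnectedCorr_actionDensity_zero (hS : (1 : ZMod S) ≠ 0) (hρ : Continuous ρ)
    {n : ℕ} (hn : ((n : ℕ) : ZMod S) ≠ 0) :
    latticeConnectedCorr ρ 0 S (actionDensity ρ) (actionDensity ρ) n = 0 := by
  unfold latticeConnectedCorr
  rw [wilsonMeasure_zero]
  simp only [actionDensity_shift_torusLift, actionDensity_torusLift]
  have hx : (0 : Site 4 S) ≠ Torus.proj S (Pi.single 0 (n : ℤ)) := by
    rw [proj_single, Int.cast_natCast]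
    intro h
    have := congrFun h 0
    simp only [Pi.zero_apply, Pi.single_eq_same] at this
    exact hn this.symm
  rw [integral_torusDensity_mul ρ S hS hρ hx, integral_torusDensity ρ S hS hρ,
    integral_torusDensity ρ S hS hρ, sub_self]

end BetaZero

section Scheme

variable {ι : Type}

/-- Along a scheme with `a_k ≤ 1`, the torus half-side eventually exceeds any bound. [folklore] -/
theorem eventually_le_L (sch : SpeciesScheme ι) (ha : ∀ k, sch.a k ≤ 1) (C : ℝ) :
    ∀ᶠ k in atTop, C ≤ sch.L k := by
  filter_upwards [sch.tendsto_L.eventually_ge_atTop C] with k hk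
  exact hk.trans (mul_le_of_le_one_left (Nat.cast_nonneg _) (ha k))

/-- `M`-adic spacings are at most `1` (for `M ≥ 1`). [folklore] -/
theorem a_le_one {M : ℕ} (hM : 1 ≤ M) {sch : SpeciesScheme ι} {n : ℕ → ℕ}
    (ha : ∀ k, sch.a k = ((M : ℝ) ^ n k)⁻¹) (k : ℕ) : sch.a k ≤ 1 := by
  rw [ha k]
  exact inv_le_one_of_one_le₀ (one_le_pow₀ (by exact_mod_cast hM))

/-- Along an `M`-adic scheme, `t · M^{n_k} ≤ L_k` eventually (from `a_k L_k → ∞`). [folklore] -/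
theorem eventually_mul_le_L {M : ℕ} (hM : 1 ≤ M) (sch : SpeciesScheme ι) (n : ℕ → ℕ)
    (ha : ∀ k, sch.a k = ((M : ℝ) ^ n k)⁻¹) (t : ℕ) :
    ∀ᶠ k in atTop, t * M ^ n k ≤ sch.L k := by
  filter_upwards [sch.tendsto_L.eventually_ge_atTop (t : ℝ)] with k hk
  have hpos : (0 : ℝ) < (M : ℝ) ^ n k := pow_pos (by exact_mod_cast hM) _
  rw [ha k] at hk
  have : (t : ℝ) * (M : ℝ) ^ n k ≤ sch.L k := by
    calc (t : ℝ) * (M : ℝ) ^ n k ≤ ((M : ℝ) ^ n k)⁻¹ * sch.L k * (M : ℝ) ^ n k :=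
          mul_le_mul_of_nonneg_right hk hpos.le
      _ = sch.L k := by field_simp
  exact_mod_cast this

/-- A natural number strictly between `0` and `s` is a nonzero residue mod `s`. [folklore] -/
theorem natCast_zmod_ne_zero {s m : ℕ} (h0 : 0 < m) (hlt : m < s) : ((m : ℕ) : ZMod s) ≠ 0 := by
  rw [Ne, ZMod.natCast_eq_zero_iff]
  exact fun h => absurd (Nat.le_of_dvd h0 h) (not_le.2 hlt)

/-- `1 ≠ 0` in `ZMod s` for `s > 1`. [folklore] -/
theorem one_ne_zero_zmod {s : ℕ} (hs : 1 < s) : (1 : ZMod s) ≠ 0 := by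
  haveI : Fact (1 < s) := ⟨hs⟩
  exact one_ne_zero

variable {G : Type} [Group G] [TopologicalSpace G] [IsTopologicalGroup G] [CompactSpace G]
  [MeasurableSpace G] [BorelSpace G]

/-- The curvature species IS the Wilson action density. [folklore] -/
theorem curvature_F (r : LatticeRep G) : r.curvature.F = actionDensity r.ρ := rfl

/-- **Along every scheme at `β ≡ 0`, every dimensionless curvature correlator `N_t(k)` is
EVENTUALLY EXACTLY `0`** (`t ≥ 1`, `M ≥ 1`): the separation `t M^{n_k}` is eventually a proper,
nonzero residue of the torus side `2 L_k + 1 ≥ 3`. [folklore] -/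
theorem eventually_corr_eq_zero (r : LatticeRep G) {M : ℕ} (hM : 1 ≤ M)
    (sch : SpeciesScheme (YMSpecies G)) (n : ℕ → ℕ) (ha : ∀ k, sch.a k = ((M : ℝ) ^ n k)⁻¹)
    (hβ : ∀ k, sch.β k = 0) {t : ℕ} (ht : 0 < t) :
    ∀ᶠ k in atTop, latticeConnectedCorr r.ρ (sch.β k) (sch.side k) r.curvature.F r.curvature.F
      (t * M ^ n k) = 0 := by
  haveI : SecondCountableTopology G :=
    (r.continuous.isClosedEmbedding r.injective).isEmbedding.secondCountableTopology
  filter_upwards [eventually_mul_le_L hM sch n ha t,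
    eventually_le_L sch (a_le_one hM ha) 1] with k h1 h2
  have hL : 1 ≤ sch.L k := by exact_mod_cast h2
  rw [hβ k, curvature_F]
  refine latticeConnectedCorr_actionDensity_zero r.ρ (sch.side k) (one_ne_zero_zmod ?_)
    r.continuous (natCast_zmod_ne_zero (Nat.mul_pos ht (Nat.pow_pos hM)) ?_)
  · simp only [SpeciesScheme.side]; omega
  · simp only [SpeciesScheme.side]; omega

/-- **At `β ≡ 0` every `N_t(k) → 0`** (`t ≥ 1`): the tuning clause of the crux holds with
`θ = 0`, and the convergence clause holds for every `t`. [folklore] -/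
theorem tendsto_N_zero (r : LatticeRep G) {M : ℕ} (hM : 1 ≤ M)
    (sch : SpeciesScheme (YMSpecies G)) (n : ℕ → ℕ) (ha : ∀ k, sch.a k = ((M : ℝ) ^ n k)⁻¹)
    (hβ : ∀ k, sch.β k = 0) {t : ℕ} (ht : 0 < t) :
    Tendsto (fun k => ((M : ℝ) ^ n k) ^ 8 *
      latticeConnectedCorr r.ρ (sch.β k) (sch.side k) r.curvature.F r.curvature.F (t * M ^ n k))
      atTop (𝓝 0) := by
  refine tendsto_const_nhds.congr' ?_
  filter_upwards [eventually_corr_eq_zero r hM sch n ha hβ ht] with k hk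
  rw [hk, mul_zero]

end Scheme

section Gap

variable {G : Type} [Group G] [TopologicalSpace G] [IsTopologicalGroup G] [CompactSpace G]
  [MeasurableSpace G] [BorelSpace G]

omit [TopologicalSpace G] [IsTopologicalGroup G] [CompactSpace G] [BorelSpace G] [Group G]
  [MeasurableSpace G] in
/-- A cylinder function of the lifted configuration depends on the projected support. [folklore] -/
theorem dependsOn_comp_torusLift {A : LGConfig 4 G → ℝ} {T : Finset (Literature.MathematicalPhysics.QuantumLattice.ZdEdge 4)}
    (hA : DependsOn A (T : Set (Literature.MathematicalPhysics.QuantumLattice.ZdEdge 4))) (S : ℕ) :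
    DependsOn (fun U : GaugeConfig 4 S G => A (torusLift S U))
      ((T.image (torusEdge S) : Finset (Edge 4 S)) : Set (Edge 4 S)) := by
  intro U V h
  apply hA
  intro e he
  simp only [torusLift, Function.comp_apply]
  exact h _ (Finset.mem_coe.2 (Finset.mem_image_of_mem _ (Finset.mem_coe.1 he)))

omit [TopologicalSpace G] [IsTopologicalGroup G] [CompactSpace G] [BorelSpace G] [Group G] in
/-- A shifted cylinder function of the lifted configuration depends on the shifted projected
support. [folklore] -/
theorem dependsOn_shift_comp_torusLift {B : LGConfig 4 G → ℝ} {T : Finset (Literature.MathematicalPhysics.QuantumLattice.ZdEdge 4)}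
    (hB : DependsOn B (T : Set (Literature.MathematicalPhysics.QuantumLattice.ZdEdge 4))) (v : Literature.Probability.LatticeModels.Site 4)
    (S : ℕ) :
    DependsOn (fun U : GaugeConfig 4 S G => B (configShift (-v) (torusLift S U)))
      ((T.image fun e => torusEdge S (e.1 + v, e.2) : Finset (Edge 4 S)) : Set (Edge 4 S)) := by
  intro U V h
  apply hB
  intro e he
  simp only [configShift_apply, torusLift, Function.comp_apply, sub_neg_eq_add]
  exact h _ (Finset.mem_coe.2 (Finset.mem_image_of_mem
    (fun e : Literature.MathematicalPhysics.QuantumLattice.ZdEdge 4 => torusEdge S (e.1 + v, e.2))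
    (Finset.mem_coe.1 he)))

/-- **Time-separated supports project disjointly onto a large torus.** If all bonds of `TA`,
`TB` have time coordinate in `[-R, R]`, then for `2R + 1 ≤ n ≤ S'` and `2R ≤ S'` the
projections of `TA` and of `TB + n e₀` onto the torus of side `2S'+1` are disjoint. [folklore] -/
theorem disjoint_image_torusEdge {TA TB : Finset (Literature.MathematicalPhysics.QuantumLattice.ZdEdge 4)} {R : ℕ}
    (hA : ∀ e ∈ TA, |e.1 0| ≤ (R : ℤ)) (hB : ∀ e ∈ TB, |e.1 0| ≤ (R : ℤ)) {S' n : ℕ}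
    (hn1 : 2 * R + 1 ≤ n) (hn2 : n ≤ S') :
    Disjoint (TA.image (torusEdge (2 * S' + 1)))
      (TB.image fun e => torusEdge (2 * S' + 1) (e.1 + Pi.single 0 (n : ℤ), e.2)) := by
  rw [Finset.disjoint_left]
  rintro _ ha hb
  obtain ⟨a, haT, rfl⟩ := Finset.mem_image.1 ha
  obtain ⟨b, hbT, hab⟩ := Finset.mem_image.1 hb
  have h0 : (Torus.proj (2 * S' + 1) (b.1 + Pi.single 0 (n : ℤ))) 0 = (Torus.proj (2 * S' + 1) a.1) 0 := by
    have := (Prod.ext_iff.1 hab).1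
    simp only [torusEdge] at this
    rw [this]
  simp only [Torus.proj_apply, Pi.add_apply, Pi.single_eq_same] at h0
  rw [ZMod.intCast_eq_intCast_iff_dvd_sub] at h0
  have ha' := abs_le.1 (hA a haT)
  have hb' := abs_le.1 (hB b hbT)
  have h1 : (1 : ℤ) ≤ (b.1 0 + n) - a.1 0 := by omega
  have h2 : (b.1 0 + n) - a.1 0 < ((2 * S' + 1 : ℕ) : ℤ) := by push_cast; omega
  -- `h0 : ↑(2 S' + 1) ∣ a.1 0 - (b.1 0 + n)`
  have h3 := Int.le_of_dvd (by omega) (dvd_sub_comm.1 h0)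
  omega

/-- Expectations of bounded functions under a probability measure are bounded. [folklore] -/
theorem abs_integral_le {X : Type*} [MeasurableSpace X] (μ : Measure X) [IsProbabilityMeasure μ]
    {f : X → ℝ} {C : ℝ} (hf : ∀ x, |f x| ≤ C) : |∫ x, f x ∂μ| ≤ C := by
  have h := norm_integral_le_of_norm_le_const (μ := μ) (f := f) (C := C)
    (ae_of_all _ fun x => by rw [Real.norm_eq_abs]; exact hf x)
  rwa [probReal_univ, mul_one, Real.norm_eq_abs] at h

/-- Resampling-free factorisation on the finite product: real version of independence of
disjoint blocks. [folklore] -/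
theorem integral_mul_eq_of_dependsOn_pi {ι' : Type*} [Fintype ι'] [DecidableEq ι']
    {Y : Type*} [MeasurableSpace Y] (ν : Measure Y) [IsProbabilityMeasure ν]
    {S T : Finset ι'} (hST : Disjoint S T) {F F' : (ι' → Y) → ℝ} (hFm : Measurable F)
    (hGm : Measurable F') (hF : DependsOn F (S : Set ι')) (hG : DependsOn F' (T : Set ι')) :
    ∫ x, F x * F' x ∂Measure.pi (fun _ : ι' => ν) =
      (∫ x, F x ∂Measure.pi (fun _ : ι' => ν)) * ∫ x, F' x ∂Measure.pi (fun _ : ι' => ν) := by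
  rw [← Measure.infinitePi_eq_pi]
  exact Literature.Probability.LatticeModels.integral_mul_eq_of_dependsOn_disjoint
    (fun _ : ι' => ν) hST hFm hGm hF hG

/-- **Translation invariance** of the torus Wilson expectation of a lifted observable, in the
`configShift` form used by `latticeConnectedCorr` (every `β`). [folklore] -/
theorem integral_shift_torusLift {N : ℕ} (ρ : G →* Matrix (Fin N) (Fin N) ℂ) (β : ℝ) (S : ℕ)
    [NeZero S] (B : LGConfig 4 G → ℝ) (v : Literature.Probability.LatticeModels.Site 4) :
    ∫ U, B (configShift (-v) (torusLift S U)) ∂wilsonMeasure (d := 4) (L := S) ρ β =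
      ∫ U, B (torusLift S U) ∂wilsonMeasure (d := 4) (L := S) ρ β := by
  have h := toTorusObservable_comp_configShift (G := G) S (-v) B
  have h' : ∀ U : GaugeConfig 4 S G, B (configShift (-v) (torusLift S U)) =
      (toTorusObservable S B) (torusConfigShift (Torus.proj S (-v)) U) := fun U => by
    have := congrFun h U
    simpa [toTorusObservable] using this
  simp_rw [h']
  rw [← integral_map_equiv (torusConfigShift (Torus.proj S (-v))) (toTorusObservable S B),
    wilsonMeasure_map_torusConfigShift]
  rfl

/-- **At `β ≡ 0` every scheme has a uniform lattice mass gap of EVERY rate `Δ ≥ 0`.**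
Independent Haar links: the connected correlation of two gauge-invariant local observables
vanishes as soon as their (time-shifted) supports project disjointly onto the torus, i.e. for
all separations `n ≥ 2R+1` on all tori `2S'+1` with `S' ≥ max(L_k, 2R)`; for the finitely many
smaller `n` it is bounded by `2 C_A C_B ≤ 2 C_A C_B e^{Δ(2R+1)} e^{-Δ a_k n}` once `a_k ≤ 1`. [folklore] -/
theorem hasLatticeMassGap_beta_zero (r : LatticeRep G) (sch : SpeciesScheme (YMSpecies G))
    (hβ : ∀ k, sch.β k = 0) (ha : ∀ k, sch.a k ≤ 1) {Δ : ℝ} (hΔ : 0 ≤ Δ) :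
    HasLatticeMassGap r sch Δ := by
  classical
  intro A B
  obtain ⟨CA, hCA⟩ := A.bounded
  obtain ⟨CB, hCB⟩ := B.bounded
  set R : ℕ := (A.supp ∪ B.supp).sup fun e => (e.1 0).natAbs with hR
  have hRA : ∀ e ∈ A.supp, |e.1 0| ≤ (R : ℤ) := fun e he => by
    have : (e.1 0).natAbs ≤ R := Finset.le_sup (f := fun e : Literature.MathematicalPhysics.QuantumLattice.ZdEdge 4 => (e.1 0).natAbs)
      (Finset.mem_union_left _ he)
    rw [← Int.natCast_natAbs]; exact_mod_cast this
  have hRB : ∀ e ∈ B.supp, |e.1 0| ≤ (R : ℤ) := fun e he => by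
    have : (e.1 0).natAbs ≤ R := Finset.le_sup (f := fun e : Literature.MathematicalPhysics.QuantumLattice.ZdEdge 4 => (e.1 0).natAbs)
      (Finset.mem_union_right _ he)
    rw [← Int.natCast_natAbs]; exact_mod_cast this
  have hCA0 : 0 ≤ CA := (abs_nonneg _).trans (hCA fun _ => 1)
  have hCB0 : 0 ≤ CB := (abs_nonneg _).trans (hCB fun _ => 1)
  refine ⟨2 * CA * CB * Real.exp (Δ * (2 * R + 1)), Eventually.of_forall fun k S' _ n hn => ?_⟩
  haveI : IsProbabilityMeasure (wilsonMeasure (d := 4) (L := 2 * S' + 1) (G := G) r.ρ (sch.β k)) :=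
    isProbabilityMeasure_wilsonMeasure r.ρ r.continuous _
  have hK : 0 ≤ 2 * CA * CB * Real.exp (Δ * (2 * R + 1)) := by positivity
  by_cases hn0 : 2 * R + 1 ≤ n
  · -- disjoint supports: the connected correlation vanishes
    have hcorr : latticeConnectedCorr r.ρ (sch.β k) (2 * S' + 1) A.F B.F n = 0 := by
      unfold latticeConnectedCorr
      rw [hβ k, wilsonMeasure_zero]
      have hfact : ∫ U, A.F (torusLift (2 * S' + 1) U) *
            B.F (configShift (-Pi.single 0 (n : ℤ)) (torusLift (2 * S' + 1) U)) ∂piHaar (2 * S' + 1) =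
          (∫ U, A.F (torusLift (2 * S' + 1) U) ∂piHaar (2 * S' + 1)) *
            ∫ U, B.F (configShift (-Pi.single 0 (n : ℤ)) (torusLift (2 * S' + 1) U))
              ∂piHaar (2 * S' + 1) (G := G) :=
        integral_mul_eq_of_dependsOn_pi (haarProbability G) (disjoint_image_torusEdge hRA hRB hn0 hn)
          (F := fun U : GaugeConfig 4 (2 * S' + 1) G => A.F (torusLift (2 * S' + 1) U))
          (F' := fun U : GaugeConfig 4 (2 * S' + 1) G =>
            B.F (configShift (-Pi.single 0 (n : ℤ)) (torusLift (2 * S' + 1) U)))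
          (A.measurable.comp (measurable_torusLift _))
          ((B.measurable.comp (configShift _).measurable).comp (measurable_torusLift _))
          (dependsOn_comp_torusLift A.isCylinder _) (dependsOn_shift_comp_torusLift B.isCylinder _ _)
      have hshift : ∫ U, B.F (configShift (-Pi.single 0 (n : ℤ)) (torusLift (2 * S' + 1) U))
            ∂piHaar (2 * S' + 1) = ∫ U, B.F (torusLift (2 * S' + 1) U) ∂piHaar (2 * S' + 1) (G := G) := by
        rw [← wilsonMeasure_zero r.ρ]; exact integral_shift_torusLift r.ρ 0 _ B.F _
      rw [hfact, hshift, sub_self]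
    rw [hcorr, abs_zero]
    positivity
  · -- small separations: bounded by `2 C_A C_B`
    push Not at hn0
    have hb : |latticeConnectedCorr r.ρ (sch.β k) (2 * S' + 1) A.F B.F n| ≤ 2 * CA * CB := by
      unfold latticeConnectedCorr
      refine (abs_sub _ _).trans ?_
      have h1 : |∫ U, A.F (torusLift (2 * S' + 1) U) *
          B.F (configShift (-Pi.single 0 (n : ℤ)) (torusLift (2 * S' + 1) U))
            ∂wilsonMeasure (d := 4) (L := 2 * S' + 1) r.ρ (sch.β k)| ≤ CA * CB :=
        abs_integral_le _ fun U => by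
          rw [abs_mul]; exact mul_le_mul (hCA _) (hCB _) (abs_nonneg _) hCA0
      have h2 : |(∫ U, A.F (torusLift (2 * S' + 1) U) ∂wilsonMeasure (d := 4) (L := 2 * S' + 1) r.ρ (sch.β k)) *
          ∫ U, B.F (torusLift (2 * S' + 1) U) ∂wilsonMeasure (d := 4) (L := 2 * S' + 1) r.ρ (sch.β k)| ≤ CA * CB := by
        rw [abs_mul]
        exact mul_le_mul (abs_integral_le _ fun U => hCA _) (abs_integral_le _ fun U => hCB _)
          (abs_nonneg _) hCA0
      linarith
    refine hb.trans ?_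
    have hexp : Real.exp (-(Δ * (sch.a k * n))) ≥ Real.exp (-(Δ * (2 * R + 1))) := by
      apply Real.exp_le_exp.2
      have : sch.a k * n ≤ 2 * R + 1 := by
        calc sch.a k * n ≤ 1 * n := mul_le_mul_of_nonneg_right (ha k) (Nat.cast_nonneg _)
          _ ≤ 2 * R + 1 := by rw [one_mul]; exact_mod_cast hn0.le
      nlinarith
    calc 2 * CA * CB = 2 * CA * CB * Real.exp (Δ * (2 * R + 1)) * Real.exp (-(Δ * (2 * R + 1))) := by
          rw [mul_assoc (2 * CA * CB), ← Real.exp_add, add_neg_cancel, Real.exp_zero, mul_one]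
      _ ≤ 2 * CA * CB * Real.exp (Δ * (2 * R + 1)) * Real.exp (-(Δ * (sch.a k * n))) :=
          mul_le_mul_of_nonneg_left hexp hK

end Gap

end

end Summit.QuantumFields.YangMills.Theorems.ContinuumLimitOnTrajectory.Negative
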